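import Mathlib
import Literature.Combinatorics.SetFamily.AhlswedeDaykinDifferences
import Summits.CriticalPhenomena.PercolationContinuityZ3.Theorems.PercNearOneGluingNoHeavyLowerTailHexMSMatchBlockReserved

/-!
# (MS2) for two-type instances with a common element, via Ahlswede–Daykin and Hall (hp-7 gen 78)

Support file for crux `stmt-CriticalPhenomena-4575` (route `PercNearOneGluingNoHeavy`), hull-port seat `prim-hp-7` (generation 78);
`--supports stmt-CriticalPhenomena-4575 --as helper`.  No `sorry`.  Memo: `run/shared/lean/prim/prim-hp-7/FROM-prim-hp-7-g78-RECTANGLES-AND-REDUCTIONS.md` §0 (G).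

The 'new-block' leaf `BlockReserved.ms2_of_blockOrder_new` needs an injective assignment of the type-5 designated sets `d ∈ D₅` to NEW second
differences `σ d = p \ d` (`p ∈ P`).  Two observations make this assignment always available when the members share an element `x`:

* every `d ∈ D₅ ⊆ P \\ Q` lies inside a member of `P` (`d = p \ q ⊆ p`), so by the Ahlswede–Daykin difference theorem in its complement form
  (Aharoni–Holzman; tree `Literature.Combinatorics.SetFamily.card_le_card_diffs_of_forall_exists_sdiff_subset`) EVERY subfamily `B ⊆ D₅` has `#B ≤ #(P \\ B)` — which is
  exactly Hall's condition for the option sets `d ↦ {p \ d : p ∈ P}`; Hall's marriage theorem (`Finset.all_card_le_biUnion_card_iff_exists_injective`)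
  then gives a system of distinct representatives `σ` (`CommonElement.exists_sdr_sdiff`, no hypothesis on `P` at all);
* if `x` belongs to every member then no difference of two members contains `x`, no designated set contains `x`, and every second difference
  `p \ d` contains `x`: all options are new and nonempty.

* `CommonElement.exists_sdr_sdiff` — for ANY finite families `P` and `D` with `D ⊆ ↓P` (each `d ∈ D` inside some member of `P`): an injective-on-`D`
  map `σ` with `σ d ∈ P \\ {d}`, i.e. `σ d = p \ d` for some `p ∈ P`.  (Ahlswede–Daykin 1979 / Aharoni–Holzman 1993 + Hall.)
* `CommonElement.ms2_of_common_element` — **(MS2) for every two-type instance with a common element**: `P`, `Q` disjoint, `x ∈ f` for all members,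
  `D₅ ⊆ P \\ Q` ARBITRARY, `D₂ ⊆ Q \\ P` pure with no `d ∈ D₂` inside a member of `P` (the depth-one constraint X2), and no member of `P` inside a member
  of `Q`.  Then `#((P ∪ Q) ∪ D₅ ∪ D₂) ≤ #((P ∪ Q) \\ (P ∪ Q) ∪ P \\ D₅ ∪ Q \\ D₂)`.  `ms2_of_common_element'` is the mirror form (types exchanged).
  Numerically (memo §0 (G)): on `2^[6]` all 145 080 admissible antichain instances with a common element are covered by it, in BOTH directions.
* `CommonElement.ms2_of_threeWise` / `'` (appended) — the sharp form: it suffices that every triple `p ∈ P, q ∈ Q, g ∈ P ∪ Q` meets (then every second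
  difference `p \ d ⊇ p ∩ q₀` meets every member, so it is not a difference of members).
-/

namespace Summit.CriticalPhenomena.PercolationContinuityZ3.Theorems

namespace CommonElement

open Finset
open scoped FinsetFamily

variable {α : Type*} [DecidableEq α]

/-- **Second differences admit a system of distinct representatives** (hp-7 gen 78; Ahlswede–Daykin 1979 + Hall).  If every member of `D` lies
inside some member of `P`, there is a map `σ`, injective on `D`, with `σ d = p \ d` for some `p ∈ P` (depending on `d`). -/
theorem exists_sdr_sdiff (P D : Finset (Finset α)) (hD : ∀ d ∈ D, ∃ p ∈ P, d ⊆ p) :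
    ∃ σ : Finset α → Finset α, Set.InjOn σ ↑D ∧ ∀ d ∈ D, ∃ p ∈ P, σ d = p \ d := by
  classical
  -- Hall's condition for the option sets `t d = {p \ d : p ∈ P}` over the index type `↥D`
  let t : ↥D → Finset (Finset α) := fun d => P.image fun p => p \ (d : Finset α)
  have hall : ∀ s : Finset ↥D, #s ≤ #(s.biUnion t) := by
    intro s
    set B : Finset (Finset α) := s.image Subtype.val with hB
    have hBD : B ⊆ D := by
      intro b hb
      obtain ⟨d, -, rfl⟩ := mem_image.mp hb
      exact d.2
    have hcardB : #B = #s := card_image_of_injective _ Subtype.val_injective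
    -- the union of the option sets is `P \\ B`
    have hunion : s.biUnion t = P \\ B := by
      ext E
      simp only [mem_biUnion, mem_diffs, hB, mem_image, t]
      constructor
      · rintro ⟨d, hds, p, hp, rfl⟩
        exact ⟨p, hp, (d : Finset α), ⟨d, hds, rfl⟩, rfl⟩
      · rintro ⟨p, hp, b, ⟨d, hds, rfl⟩, rfl⟩
        exact ⟨d, hds, p, hp, rfl⟩
    -- Ahlswede–Daykin / Aharoni–Holzman: `#B ≤ #(P \\ B)` since `B ⊆ ↓P`
    have hAD : #B ≤ #(P \\ B) := by
      refine Literature.Combinatorics.SetFamily.card_le_card_diffs_of_forall_exists_sdiff_subset P B ?_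
      intro B₁ hB₁ B₂ _
      obtain ⟨p, hp, hsub⟩ := hD B₁ (hBD hB₁)
      exact ⟨p, hp, sdiff_subset.trans hsub⟩
    rw [hunion, ← hcardB]
    exact hAD
  obtain ⟨f, hfinj, hf⟩ := (Finset.all_card_le_biUnion_card_iff_exists_injective t).mp hall
  refine ⟨fun d => if h : d ∈ D then f ⟨d, h⟩ else ∅, ?_, ?_⟩
  · intro d hd d' hd' h
    simp only [mem_coe] at hd hd'
    simp only [dif_pos hd, dif_pos hd'] at h
    have := hfinj h
    simpa using this
  · intro d hd
    have hmem := hf ⟨d, hd⟩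
    obtain ⟨p, hp, hpe⟩ := mem_image.mp hmem
    refine ⟨p, hp, ?_⟩
    simp only [dif_pos hd]
    exact hpe.symm

/-- **(MS2) for two-type instances with a common element** (hp-7 gen 78).  `P`, `Q` disjoint families all of whose members contain `x`;
`D₅ ⊆ P \\ Q` arbitrary; `D₂ ⊆ Q \\ P` pure and with no member inside a member of `P`; no member of `P` inside a member of `Q`.  Then
`#((P ∪ Q) ∪ D₅ ∪ D₂) ≤ #((P ∪ Q) \\ (P ∪ Q) ∪ P \\ D₅ ∪ Q \\ D₂)`.  (Block order `P < Q`, type-2 sets reserved as themselves, type-5 sets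
re-reserved to the distinct NEW second differences of `exists_sdr_sdiff` — new because they contain `x` while no difference of members does.) -/
theorem ms2_of_common_element (P Q D₅ D₂ : Finset (Finset α)) (hPQ : Disjoint P Q) (x : α)
    (hx : ∀ f ∈ P ∪ Q, x ∈ f)
    (hD₅ : D₅ ⊆ P \\ Q) (hD₂ : D₂ ⊆ Q \\ P)
    (hpure₂ : ∀ d ∈ D₂, d ∉ (P \\ P) ∪ (Q \\ Q)) (hX2 : ∀ d ∈ D₂, ∀ p ∈ P, ¬ d ⊆ p)
    (hcont : ∀ p ∈ P, ∀ q ∈ Q, ¬ p ⊆ q) :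
    #((P ∪ Q) ∪ D₅ ∪ D₂) ≤ #(((P ∪ Q) \\ (P ∪ Q)) ∪ (P \\ D₅) ∪ (Q \\ D₂)) := by
  classical
  -- no difference of two members contains `x`
  have hxdiff : ∀ t ∈ (P ∪ Q) \\ (P ∪ Q), x ∉ t := by
    intro t ht hxt
    obtain ⟨f, -, g, hg, rfl⟩ := mem_diffs.mp ht
    exact (mem_sdiff.mp hxt).2 (hx g hg)
  -- every type-5 set lies inside a member of `P` and misses `x`
  have hD₅P : ∀ d ∈ D₅, ∃ p ∈ P, d ⊆ p := by
    intro d hd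
    obtain ⟨p, hp, q, -, rfl⟩ := mem_diffs.mp (hD₅ hd)
    exact ⟨p, hp, sdiff_subset⟩
  have hxD₅ : ∀ d ∈ D₅, x ∉ d := by
    intro d hd hxd
    obtain ⟨p, hp, q, hq, rfl⟩ := mem_diffs.mp (hD₅ hd)
    exact (mem_sdiff.mp hxd).2 (hx q (mem_union_right _ hq))
  obtain ⟨σ, hσinj, hσ⟩ := exists_sdr_sdiff P D₅ hD₅P
  have hrev₂ : ∀ d ∈ D₂, d ∉ P \\ Q := by
    intro d hd h
    obtain ⟨p, hp, q, -, rfl⟩ := mem_diffs.mp h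
    exact hX2 _ hd p hp sdiff_subset
  refine BlockReserved.ms2_of_blockOrder_new P Q D₅ D₂ hPQ hD₅ hD₂ hpure₂ hrev₂ hcont σ ?_ hσinj
  intro d hd
  obtain ⟨p, hp, hpd⟩ := hσ d hd
  have hxσ : x ∈ σ d := by
    rw [hpd, mem_sdiff]
    exact ⟨hx p (mem_union_left _ hp), hxD₅ d hd⟩
  refine ⟨?_, fun h => hxdiff _ h hxσ⟩
  rw [hpd]
  exact mem_diffs.mpr ⟨p, hp, d, hd, rfl⟩

/-- The mirror form of `ms2_of_common_element` (hp-7 gen 78): common element, `D₂ ⊆ Q \\ P` arbitrary, `D₅ ⊆ P \\ Q` pure with no member inside a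
member of `Q`, and no member of `Q` inside a member of `P`. -/
theorem ms2_of_common_element' (P Q D₅ D₂ : Finset (Finset α)) (hPQ : Disjoint P Q) (x : α)
    (hx : ∀ f ∈ P ∪ Q, x ∈ f)
    (hD₅ : D₅ ⊆ P \\ Q) (hD₂ : D₂ ⊆ Q \\ P)
    (hpure₅ : ∀ d ∈ D₅, d ∉ (P \\ P) ∪ (Q \\ Q)) (hX1 : ∀ d ∈ D₅, ∀ q ∈ Q, ¬ d ⊆ q)
    (hcont : ∀ q ∈ Q, ∀ p ∈ P, ¬ q ⊆ p) :
    #((P ∪ Q) ∪ D₅ ∪ D₂) ≤ #(((P ∪ Q) \\ (P ∪ Q)) ∪ (P \\ D₅) ∪ (Q \\ D₂)) := by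
  classical
  have hx' : ∀ f ∈ Q ∪ P, x ∈ f := fun f hf => hx f (by rw [union_comm]; exact hf)
  have hpure₅' : ∀ d ∈ D₅, d ∉ (Q \\ Q) ∪ (P \\ P) := fun d hd h => by
    rcases mem_union.mp h with h | h
    · exact hpure₅ d hd (mem_union_right _ h)
    · exact hpure₅ d hd (mem_union_left _ h)
  have h := ms2_of_common_element Q P D₂ D₅ hPQ.symm x hx' hD₂ hD₅ hpure₅' hX1 hcont
  have e1 : (Q ∪ P) ∪ D₂ ∪ D₅ = (P ∪ Q) ∪ D₅ ∪ D₂ := by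
    rw [union_comm Q P, union_assoc, union_comm D₂ D₅, ← union_assoc]
  have e2 : ((Q ∪ P) \\ (Q ∪ P)) ∪ (Q \\ D₂) ∪ (P \\ D₅) = ((P ∪ Q) \\ (P ∪ Q)) ∪ (P \\ D₅) ∪ (Q \\ D₂) := by
    rw [union_comm Q P, union_assoc, union_comm (Q \\ D₂) (P \\ D₅), ← union_assoc]
  rw [e1, e2] at h
  exact h


/-! ### Appended (hp-7 gen 78): the sharp form — 3-wise cross-intersecting blocks

The only use of the common element above is that every second difference `p \ d` (`d = p₀ \ q₀ ∈ D₅`) is NOT a difference of two members.  Since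
`p \ d ⊇ p ∩ q₀`, this already follows when every triple `p ∈ P`, `q ∈ Q`, `g ∈ P ∪ Q` has a common element (`f \ g` misses `g`, while `p ∩ q₀` meets
`g`).  Families such as all 3-subsets of a 4-set are 3-wise intersecting without a common element. -/

/-- **(MS2) for 3-wise cross-intersecting two-type instances** (hp-7 gen 78).  `P`, `Q` disjoint with `p ∩ q ∩ g ≠ ∅` for all `p ∈ P`, `q ∈ Q`,
`g ∈ P ∪ Q`; `D₅ ⊆ P \\ Q` arbitrary; `D₂ ⊆ Q \\ P` pure with no member inside a member of `P`; no member of `P` inside a member of `Q`.  Then (MS2)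
holds for `(P, Q, D₅, D₂)`. -/
theorem ms2_of_threeWise (P Q D₅ D₂ : Finset (Finset α)) (hPQ : Disjoint P Q)
    (h3 : ∀ p ∈ P, ∀ q ∈ Q, ∀ g ∈ P ∪ Q, (p ∩ q ∩ g).Nonempty)
    (hD₅ : D₅ ⊆ P \\ Q) (hD₂ : D₂ ⊆ Q \\ P)
    (hpure₂ : ∀ d ∈ D₂, d ∉ (P \\ P) ∪ (Q \\ Q)) (hX2 : ∀ d ∈ D₂, ∀ p ∈ P, ¬ d ⊆ p)
    (hcont : ∀ p ∈ P, ∀ q ∈ Q, ¬ p ⊆ q) :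
    #((P ∪ Q) ∪ D₅ ∪ D₂) ≤ #(((P ∪ Q) \\ (P ∪ Q)) ∪ (P \\ D₅) ∪ (Q \\ D₂)) := by
  classical
  have hD₅P : ∀ d ∈ D₅, ∃ p ∈ P, d ⊆ p := by
    intro d hd
    obtain ⟨p, hp, q, -, rfl⟩ := mem_diffs.mp (hD₅ hd)
    exact ⟨p, hp, sdiff_subset⟩
  obtain ⟨σ, hσinj, hσ⟩ := exists_sdr_sdiff P D₅ hD₅P
  have hrev₂ : ∀ d ∈ D₂, d ∉ P \\ Q := by
    intro d hd h
    obtain ⟨p, hp, q, -, rfl⟩ := mem_diffs.mp h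
    exact hX2 _ hd p hp sdiff_subset
  refine BlockReserved.ms2_of_blockOrder_new P Q D₅ D₂ hPQ hD₅ hD₂ hpure₂ hrev₂ hcont σ ?_ hσinj
  intro d hd
  obtain ⟨p, hp, hpd⟩ := hσ d hd
  obtain ⟨p₀, hp₀, q₀, hq₀, hdq⟩ := mem_diffs.mp (hD₅ hd)
  refine ⟨?_, ?_⟩
  · rw [hpd]
    exact mem_diffs.mpr ⟨p, hp, d, hd, rfl⟩
  · intro hmem
    obtain ⟨f, -, g, hg, hfg⟩ := mem_diffs.mp hmem
    obtain ⟨y, hy⟩ := h3 p hp q₀ hq₀ g hg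
    rw [mem_inter, mem_inter] at hy
    -- `y ∈ p ∩ q₀` lies in `p \ d = f \ g`, hence `y ∉ g`: contradiction
    have hyd : y ∉ d := by
      rw [← hdq, mem_sdiff, not_and, not_not]
      exact fun _ => hy.1.2
    have hy' : y ∈ σ d := by
      rw [hpd, mem_sdiff]
      exact ⟨hy.1.1, hyd⟩
    rw [← hfg, mem_sdiff] at hy'
    exact hy'.2 hy.2

/-- The mirror form of `ms2_of_threeWise` (hp-7 gen 78). -/
theorem ms2_of_threeWise' (P Q D₅ D₂ : Finset (Finset α)) (hPQ : Disjoint P Q)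
    (h3 : ∀ q ∈ Q, ∀ p ∈ P, ∀ g ∈ Q ∪ P, (q ∩ p ∩ g).Nonempty)
    (hD₅ : D₅ ⊆ P \\ Q) (hD₂ : D₂ ⊆ Q \\ P)
    (hpure₅ : ∀ d ∈ D₅, d ∉ (P \\ P) ∪ (Q \\ Q)) (hX1 : ∀ d ∈ D₅, ∀ q ∈ Q, ¬ d ⊆ q)
    (hcont : ∀ q ∈ Q, ∀ p ∈ P, ¬ q ⊆ p) :
    #((P ∪ Q) ∪ D₅ ∪ D₂) ≤ #(((P ∪ Q) \\ (P ∪ Q)) ∪ (P \\ D₅) ∪ (Q \\ D₂)) := by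
  classical
  have hpure₅' : ∀ d ∈ D₅, d ∉ (Q \\ Q) ∪ (P \\ P) := fun d hd h => by
    rcases mem_union.mp h with h | h
    · exact hpure₅ d hd (mem_union_right _ h)
    · exact hpure₅ d hd (mem_union_left _ h)
  have h := ms2_of_threeWise Q P D₂ D₅ hPQ.symm h3 hD₂ hD₅ hpure₅' hX1 hcont
  have e1 : (Q ∪ P) ∪ D₂ ∪ D₅ = (P ∪ Q) ∪ D₅ ∪ D₂ := by
    rw [union_comm Q P, union_assoc, union_comm D₂ D₅, ← union_assoc]
  have e2 : ((Q ∪ P) \\ (Q ∪ P)) ∪ (Q \\ D₂) ∪ (P \\ D₅) = ((P ∪ Q) \\ (P ∪ Q)) ∪ (P \\ D₅) ∪ (Q \\ D₂) := by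
    rw [union_comm Q P, union_assoc, union_comm (Q \\ D₂) (P \\ D₅), ← union_assoc]
  rw [e1, e2] at h
  exact h

end CommonElement

end Summit.CriticalPhenomena.PercolationContinuityZ3.Theorems
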